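import Summits.BirchSwinnertonDyer.BirchSwinnertonDyer.Theorems.KolyvaginRoadThreeZhangSupplySignedAssembled
import Summits.BirchSwinnertonDyer.BirchSwinnertonDyer.Theorems.KolyvaginRoadThreeMethod2LocalDictionaries
import HarnessLib

/-!
# Route `KolyvaginRoadThree`, deciding crux `ZhangSharpFrameAtThreeHL` (item stmt-BirchSwinnertonDyer-19574):
# (IsoBound) `hbound` of S2-ENGINE's (Supply) from a LOCAL SIGN-PLANE — the linear algebra of a hyperbolic plane
# (cell `bsd-stepL`, ACCEL seat `bsd-stepL-koly3b` g6; `--supports stmt-BirchSwinnertonDyer-19574`, helper; part XXIII of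
# the `KolyvaginRoadThreeZhangSupply*` series)

HONEST FRAMING. Theorems only; 0 definitions, 0 named facts, 0 `sorry`; pure linear algebra + bookkeeping; closes nothing
(T7). PARTITION: O2@3 (B10) × A1 × crux 19574 × the S2-ENGINE's (Supply) binder — proves-glue.

WHAT. The binder `hbound` of `supply_signed_of_jump_bound` (part XIII): at a Kolyvagin prime `λ`, two classes `x, y` of
the same sign `s` whose localisations are mutually and self isotropic for `b_λ`, with `loc_λ x ≠ 0`, have proportional
localisations. §1 `exists_smul_eq_of_isotropic_of_mem_span`: in a plane `F u ⊕ F w` over a field with `b(u,u) = b(w,w) =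
0` and `b(u,w) ≠ 0` (NO symmetry of `b` is assumed), two mutually and self isotropic vectors `z₁ ≠ 0`, `z₂` are
proportional (case analysis on `b(u,w) + b(w,u)`). §2 `hbound_of_signPlane`: `hbound` VERBATIM follows once, for every
Kolyvagin `ℓ` and sign `s`, the localisations of the sign-`s` classes lie in such a plane of `H¹(K_λ, E[3])` (the LOCAL
SIGN-PLANE (SP): `H¹(K_λ, E[3])^{s} = H¹_f^{s} ⊕ H¹_tr^{s}`, Gross Prop. 8.1–8.2 ∕ W. Zhang §8.1 — kept as the hypothesis
`hSP`; the unramified line is isotropic by the Kummer isotropy, the transverse line by (Tr-iso), and they pair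
non-trivially by (Perf)), and `ker loc_λ = torsionLocalKer_λ` (zhang3-p1 `ker_localization_eq_torsionLocalKer`).

References: [cite: GrossLMS1991, Prop. 8.1–8.2] [cite: WZhang2014, §8.1, Lemma 8.2] [cite: McCallumLMS1991, Lemma 5.3].
-/

noncomputable section

open scoped Classical

namespace Summit.BirchSwinnertonDyer.Rank1Residual.X11b.Three.Koly.ZhangSupply

/-! ## §1 Linear algebra: isotropic vectors of a hyperbolic plane are proportional -/

/-- **Isotropic pairs in a plane `F u ⊕ F w` with `b(u,u) = b(w,w) = 0`, `b(u,w) ≠ 0` are proportional.** For a bilinear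
form `b` (no symmetry assumed) on a vector space over a field, `u, w` with `b u u = 0`, `b w w = 0`, `b u w ≠ 0`, and
`z₁, z₂ ∈ span {u, w}` with `b zᵢ zⱼ = 0` for all `i, j` and `z₁ ≠ 0`: `z₂ = a • z₁` for some `a`. (If
`b(u,w) + b(w,u) ≠ 0` each `zᵢ` lies on an axis and the cross terms force the same axis; if `b(w,u) = −b(u,w)` the form is
alternating on the plane and `b(z₁,z₂) = det(z₁,z₂) · b(u,w)`.) [cite: McCallumLMS1991, Lemma 5.3] -/
theorem exists_smul_eq_of_isotropic_of_mem_span {F V : Type*} [Field F] [AddCommGroup V] [Module F V]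
    (b : V →ₗ[F] V →ₗ[F] F) {u w : V} (huu : b u u = 0) (hww : b w w = 0) (huw : b u w ≠ 0) {z₁ z₂ : V}
    (hz₁ : z₁ ∈ Submodule.span F {u, w}) (hz₂ : z₂ ∈ Submodule.span F {u, w}) (h11 : b z₁ z₁ = 0)
    (h12 : b z₁ z₂ = 0) (h21 : b z₂ z₁ = 0) (hz₁0 : z₁ ≠ 0) : ∃ a : F, z₂ = a • z₁ := by
  obtain ⟨α₁, γ₁, rfl⟩ := Submodule.mem_span_pair.mp hz₁
  obtain ⟨α₂, γ₂, rfl⟩ := Submodule.mem_span_pair.mp hz₂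
  set e := b u w with he
  set e' := b w u with he'
  -- expand the three vanishing pairings
  have E11 : α₁ * γ₁ * (e + e') = 0 := by
    have h := h11
    simp only [map_add, map_smul, LinearMap.add_apply, LinearMap.smul_apply, smul_eq_mul, huu, hww] at h
    linear_combination h
  have E12 : α₁ * γ₂ * e + γ₁ * α₂ * e' = 0 := by
    have h := h12
    simp only [map_add, map_smul, LinearMap.add_apply, LinearMap.smul_apply, smul_eq_mul, huu, hww] at h
    linear_combination h
  have E21 : α₂ * γ₁ * e + γ₂ * α₁ * e' = 0 := by
    have h := h21
    simp only [map_add, map_smul, LinearMap.add_apply, LinearMap.smul_apply, smul_eq_mul, huu, hww] at h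
    linear_combination h
  by_cases hsum : e + e' = 0
  · -- alternating case: `b(z₁, z₂) = (α₁γ₂ − γ₁α₂) e`
    have he'e : e' = -e := by linear_combination hsum
    have hdet : (α₁ * γ₂ - γ₁ * α₂) * e = 0 := by rw [he'e] at E12; linear_combination E12
    have hdet' : α₁ * γ₂ = γ₁ * α₂ := by
      have := mul_eq_zero.mp hdet
      rcases this with h | h
      · linear_combination h
      · exact absurd h huw
    by_cases hα₁ : α₁ = 0
    · have hγ₁ : γ₁ ≠ 0 := by
        rintro rfl; apply hz₁0; rw [hα₁, zero_smul, zero_smul, add_zero]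
      have hα₂ : α₂ = 0 := by
        rw [hα₁, zero_mul] at hdet'
        exact (mul_eq_zero.mp hdet'.symm).resolve_left hγ₁
      refine ⟨γ₂ / γ₁, ?_⟩
      rw [hα₁, hα₂]
      simp only [zero_smul, zero_add, smul_smul, div_mul_cancel₀ _ hγ₁]
    · refine ⟨α₂ / α₁, ?_⟩
      rw [smul_add, smul_smul, smul_smul, div_mul_cancel₀ _ hα₁]
      congr 1
      have : α₂ / α₁ * γ₁ = γ₂ := by
        field_simp
        linear_combination -hdet'
      rw [this]
  · -- hyperbolic case: each vector lies on an axis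
    have hαγ : α₁ * γ₁ = 0 := by
      have := mul_eq_zero.mp E11
      rcases this with h | h
      · exact h
      · exact absurd h hsum
    rcases mul_eq_zero.mp hαγ with hα₁ | hγ₁
    · -- `z₁ = γ₁ w`
      have hγ₁ : γ₁ ≠ 0 := by
        rintro rfl; apply hz₁0; rw [hα₁, zero_smul, zero_smul, add_zero]
      have hα₂ : α₂ = 0 := by
        rw [hα₁, mul_zero, zero_mul, add_zero] at E21
        have := mul_eq_zero.mp E21
        rcases this with h | h
        · exact (mul_eq_zero.mp h).resolve_right hγ₁
        · exact absurd h huw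
      refine ⟨γ₂ / γ₁, ?_⟩
      rw [hα₁, hα₂]
      simp only [zero_smul, zero_add, smul_smul, div_mul_cancel₀ _ hγ₁]
    · -- `z₁ = α₁ u`
      have hα₁ : α₁ ≠ 0 := by
        rintro rfl; apply hz₁0; rw [hγ₁, zero_smul, zero_smul, add_zero]
      have hγ₂ : γ₂ = 0 := by
        rw [hγ₁, zero_mul, zero_mul, add_zero] at E12
        have := mul_eq_zero.mp E12
        rcases this with h | h
        · exact (mul_eq_zero.mp h).resolve_left hα₁
        · exact absurd h huw
      refine ⟨α₂ / α₁, ?_⟩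
      rw [hγ₁, hγ₂]
      simp only [zero_smul, add_zero, smul_smul, div_mul_cancel₀ _ hα₁]

/-! ## §2 `hbound` from the local sign-plane -/

open WeierstrassCurve NumberField IsDedekindDomain
  Literature.NumberTheory.EllipticCurves Literature.NumberTheory.EllipticCurves.ModularForms
  Literature.NumberTheory.GaloisRepresentations
open Summit.BirchSwinnertonDyer.Rank1Residual.X11b.Three.Koly.Method2

variable (W : WeierstrassCurve ℚ) (K : Type) [Field K] [NumberField K] [W.IsElliptic] [W.IsGloballyMinimal]
  (c : K ≃ₐ[ℚ] K) [Module (ZMod 3) (V3 W K)]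
  [∀ v : Place K, Module (ZMod 3)
    (galoisCohomology (((W.baseChange K).torsionGaloisModule ((3 ^ 1 : ℕ) : ℤ)).toLocal v) 1)]

/-- **(IsoBound) `hbound` from the LOCAL SIGN-PLANE (SP).** For the genuine localisation `loc` and any bilinear local
forms `b`: if at every Kolyvagin `λ = plK ℓ` and for each sign `s` there are local classes `u, w ∈ H¹(K_λ, E[3])` with
`b(u,u) = b(w,w) = 0`, `b(u,w) ≠ 0`, such that `loc_λ x ∈ span {u, w}` for every `x ∈ H¹(K, E[3])` of sign `s` (hypothesis
`hSP`), then the binder `hbound` of `supply_signed_of_jump_bound` holds VERBATIM (§1 + `ker loc_λ = torsionLocalKer_λ`).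
[cite: GrossLMS1991, Prop. 8.1–8.2] [cite: WZhang2014, §8.1] [cite: McCallumLMS1991, Lemma 5.3] -/
theorem hbound_of_signPlane
    (loc : (v : Place K) → V3 W K →ₗ[ZMod 3]
      galoisCohomology (((W.baseChange K).torsionGaloisModule ((3 ^ 1 : ℕ) : ℤ)).toLocal v) 1)
    (hloc : ∀ (v : Place K) (x : V3 W K),
      loc v x = galoisCohomology.localization ((W.baseChange K).torsionGaloisModule ((3 ^ 1 : ℕ) : ℤ)) v 1 x)
    (plK : {ℓ // Zhang2014.IsKolyvaginPrime (W.conductorNorm ℤ) W K 3 ℓ} → HeightOneSpectrum (𝓞 K))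
    (b : (v : Place K) →
      galoisCohomology (((W.baseChange K).torsionGaloisModule ((3 ^ 1 : ℕ) : ℤ)).toLocal v) 1 →ₗ[ZMod 3]
      galoisCohomology (((W.baseChange K).torsionGaloisModule ((3 ^ 1 : ℕ) : ℤ)).toLocal v) 1 →ₗ[ZMod 3] ZMod 3)
    (hSP : ∀ (ℓ : {ℓ // Zhang2014.IsKolyvaginPrime (W.conductorNorm ℤ) W K 3 ℓ}) (s : Bool),
      ∃ u w : galoisCohomology (((W.baseChange K).torsionGaloisModule ((3 ^ 1 : ℕ) : ℤ)).toLocal (Sum.inr (plK ℓ))) 1,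
        b (Sum.inr (plK ℓ)) u u = 0 ∧ b (Sum.inr (plK ℓ)) w w = 0 ∧ b (Sum.inr (plK ℓ)) u w ≠ 0 ∧
        ∀ x : V3 W K, conjAct W c ((3 ^ 1 : ℕ) : ℤ) x = sgn s • x →
          loc (Sum.inr (plK ℓ)) x ∈ Submodule.span (ZMod 3) {u, w}) :
    ∀ (ℓ : {ℓ // Zhang2014.IsKolyvaginPrime (W.conductorNorm ℤ) W K 3 ℓ}) (s : Bool) (x y : V3 W K),
      conjAct W c ((3 ^ 1 : ℕ) : ℤ) x = sgn s • x → conjAct W c ((3 ^ 1 : ℕ) : ℤ) y = sgn s • y →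
      b (Sum.inr (plK ℓ)) (loc (Sum.inr (plK ℓ)) x) (loc (Sum.inr (plK ℓ)) x) = 0 →
      b (Sum.inr (plK ℓ)) (loc (Sum.inr (plK ℓ)) x) (loc (Sum.inr (plK ℓ)) y) = 0 →
      b (Sum.inr (plK ℓ)) (loc (Sum.inr (plK ℓ)) y) (loc (Sum.inr (plK ℓ)) x) = 0 →
      b (Sum.inr (plK ℓ)) (loc (Sum.inr (plK ℓ)) y) (loc (Sum.inr (plK ℓ)) y) = 0 →
      x ∉ (W.baseChange K).torsionLocalKer ((plK ℓ).adicCompletion K) ((3 ^ 1 : ℕ) : ℤ) →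
      ∃ a : ℤ, y - a • x ∈ (W.baseChange K).torsionLocalKer ((plK ℓ).adicCompletion K) ((3 ^ 1 : ℕ) : ℤ) := by
  intro ℓ s x y hxs hys h11 h12 h21 _h22 hx0
  obtain ⟨u, w, huu, hww, huw, hspan⟩ := hSP ℓ s
  have hker : ∀ z : V3 W K, loc (Sum.inr (plK ℓ)) z = 0 ↔
      z ∈ (W.baseChange K).torsionLocalKer ((plK ℓ).adicCompletion K) ((3 ^ 1 : ℕ) : ℤ) := fun z ↦ by
    rw [hloc, mem_torsionLocalKer_iff_localization_eq_zero]
  have hz₁0 : loc (Sum.inr (plK ℓ)) x ≠ 0 := fun h ↦ hx0 ((hker x).mp h)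
  obtain ⟨a, ha⟩ := exists_smul_eq_of_isotropic_of_mem_span (b (Sum.inr (plK ℓ))) huu hww huw (hspan x hxs)
    (hspan y hys) h11 h12 h21 hz₁0
  refine ⟨(a.val : ℤ), (hker _).mp ?_⟩
  rw [map_sub, map_zsmul, ha]
  -- `(a.val : ℤ) • z = a • z` on a `ZMod 3`-module
  have hval : ((a.val : ℤ)) • loc (Sum.inr (plK ℓ)) x = a • loc (Sum.inr (plK ℓ)) x := by
    rw [natCast_zsmul, ← Nat.cast_smul_eq_nsmul (ZMod 3), ZMod.natCast_zmod_val]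
  rw [hval, sub_self]
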